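import Literature.AnabelianGeometry.AbsoluteAnabelian.ProfiniteOuterSemidirectProductLevelsContinuous
import HarnessLib

/-!
# Continuity of an outer action `J → Out(G)` ⟺ continuity along the characteristic levels ([SemiAnbd] §0 p. 5)

Mochizuki, *Semi-graphs of anabelioids*, Publ. RIMS **42** (2006), §0 p. 5 [cite: MochizukiSemiAnbd2006, §0 p.5]
(`J → Out(G)` a continuous homomorphism of topological groups).

PROOF-ONLY file (abc-iut cell, GAP row «G-P13-GR», abc-iut-w5-d151 g4) closing the interface between the two
inputs in the tree for the profinite `G ⋊^out J` (`G` profinite, topologically finitely generated):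
(i) a CONTINUOUS homomorphism `J → outProfinite hG` (`ProfiniteOuterSemidirectProduct.lean`), and
(ii) an algebraic `ρ : J →* TopOut G` continuous ALONG THE LEVELS `charOpenCore G d` (the hypothesis
`hcont` of abc-iut-L3-d5's `OuterSemidirectProductProfinite.lean`):

* `profiniteAut_nhds_one_hasBasis` — the level kernels `{a | a_d = 1}` form a neighbourhood basis of `1`
  in `profiniteAut hG` (product of discrete groups; compatible families);
* `continuous_outEquiv_comp_iff_levels` — for `ρ : J →* TopOut G`, the homomorphism
  `outEquiv hG ∘ ρ : J → outProfinite hG` is continuous IFF `ρ` is continuous along every level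
  `charOpenCore G d`.  (⇐ uses the basis; ⇒ is `levels_continuous_of_continuous`.)

Nothing here bears on [IUTchIII] Cor. 3.12.
-/

namespace Literature.AnabelianGeometry.AbsoluteAnabelian

open Literature.AnabelianGeometry.EtaleTheta Literature.AnabelianGeometry.SemiGraphs
open Filter Topology

universe u

variable {G : Type u} [Group G] [TopologicalSpace G] [IsTopologicalGroup G] [CompactSpace G]
  (hG : IsTopologicallyFinitelyGenerated G)

/-- **The level kernels `{a | a_d = 1}` form a neighbourhood basis of `1` in `profiniteAut hG`**: a
neighbourhood of `1` in the product of the discrete groups `Aut(G)/A_d` contains a finite cylinder, and a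
compatible family trivial at level `max` of the cylinder's indices is trivial at all of them.
[cite: MochizukiSemiAnbd2006, §0 p.5] -/
theorem profiniteAut_nhds_one_hasBasis :
    (𝓝 (1 : profiniteAut hG)).HasBasis (fun _ : ℕ => True)
      (fun d => {a : profiniteAut hG | (a.1 d : contMulAut G ⧸ autLevelKer G d) = 1}) := by
  letI τ : ∀ n : ℕ, TopologicalSpace (contMulAut G ⧸ autLevelKer G n) := fun _ => ⊥
  haveI : ∀ n : ℕ, DiscreteTopology (contMulAut G ⧸ autLevelKer G n) := fun _ => ⟨rfl⟩
  refine ⟨fun U => ⟨fun hU => ?_, ?_⟩⟩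
  · -- `U ⊇ val ⁻¹' V`, `V` a neighbourhood of `1` in the product, containing a finite cylinder
    obtain ⟨V, hV, hVU⟩ := (mem_nhds_induced Subtype.val (1 : profiniteAut hG) U).1 hU
    rw [show Subtype.val (1 : profiniteAut hG) = (1 : ∀ n : ℕ, contMulAut G ⧸ autLevelKer G n) from rfl,
      nhds_pi, Filter.mem_pi'] at hV
    obtain ⟨I, t, ht, hIt⟩ := hV
    -- a bound for the finite index set
    obtain ⟨m, hm⟩ : ∃ m : ℕ, ∀ n ∈ I, n ≤ m :=
      ⟨I.sup id, fun n hn => Finset.le_sup (f := id) hn⟩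
    refine ⟨m, trivial, fun a ha => hVU ?_⟩
    rw [Set.mem_preimage]
    apply hIt
    intro n hn
    -- `a_n = trans (a_m) = trans 1 = 1 ∈ t n`
    have h1 : (1 : contMulAut G ⧸ autLevelKer G n) ∈ t n := by
      have := ht n
      rw [Pi.one_apply, nhds_discrete, Filter.mem_pure] at this
      exact this
    have han : (a.1 n : contMulAut G ⧸ autLevelKer G n) = 1 := by
      rw [← a.2 n m (hm n hn), ha, map_one]
    change a.1 n ∈ t n
    rw [han]
    exact h1
  · rintro ⟨d, -, hdU⟩
    exact Filter.mem_of_superset ((isOpen_profiniteAut_level hG d).mem_nhds rfl) hdU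

variable [TotallyDisconnectedSpace G] {J : Type u} [Group J] [TopologicalSpace J] [IsTopologicalGroup J]
  (ρ : J →* TopOut G)

/-- **Continuity of `J → Out(G)` is continuity along the characteristic levels**: for an algebraic outer
action `ρ : J →* TopOut G` on a topologically finitely generated profinite `G`, the homomorphism
`outEquiv hG ∘ ρ : J → outProfinite hG` (profinite `Out(G)`) is CONTINUOUS iff for every `d` the set of
`j` admitting `(α, j) ∈ G ⋊^out_ρ J` with `α ≡ id (mod charOpenCore G d)` is a neighbourhood of `1` — the
hypothesis `hcont` of abc-iut-L3-d5's `compactSpace_of_levels` / `exists_profinite_topology`.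
[cite: MochizukiSemiAnbd2006, §0 p.5] -/
theorem continuous_outEquiv_comp_iff_levels :
    Continuous (fun j => outEquiv hG (ρ j)) ↔
      ∀ d : ℕ, {j : J | ∃ e : outerSemidirectProduct ρ,
        (∀ g : G, g⁻¹ * ((e.1.1 : contMulAut G) : MulAut G) g ∈ charOpenCore G d) ∧ e.1.2 = j} ∈ 𝓝 (1 : J) := by
  haveI : (innProfinite hG).Normal := range_conjProfiniteAut_normal hG
  constructor
  · intro hθ d
    -- `θ := outEquiv ∘ ρ` as a continuous homomorphism; its algebraic outer action is `ρ` again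
    let θ : J →ₜ* outProfinite hG :=
      ⟨(outEquiv hG).toMonoidHom.comp ρ, hθ⟩
    have hρ : outerActionOfContinuous hG θ = ρ := by
      ext j
      change ((outEquiv hG).symm (outEquiv hG (ρ j))) = ρ j
      rw [MulEquiv.symm_apply_apply]
    have h := levels_continuous_of_continuous hG θ d
    rw [hρ] at h
    exact h
  · intro hcont
    -- a homomorphism into a topological group is continuous once continuous at `1`
    let θ' : J →* outProfinite hG := (outEquiv hG).toMonoidHom.comp ρ
    change Continuous θ'
    refine continuous_of_continuousAt_one θ' ?_
    rw [ContinuousAt, map_one]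
    intro W hW
    -- pull `W` back to `profiniteAut hG` and shrink to a level kernel
    have h1 : outProj hG 1 = 1 := map_one (outProj hG)
    have hc : Continuous fun a : profiniteAut hG => outProj hG a := (outProj hG).continuous
    have hW' : (fun a : profiniteAut hG => outProj hG a) ⁻¹' W ∈ 𝓝 (1 : profiniteAut hG) := by
      refine hc.continuousAt.preimage_mem_nhds ?_
      rw [h1]; exact hW
    obtain ⟨d, -, hd⟩ := (profiniteAut_nhds_one_hasBasis hG).mem_iff.mp hW'
    change θ' ⁻¹' W ∈ 𝓝 (1 : J)
    refine Filter.mem_of_superset (hcont d) ?_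
    rintro j ⟨e, he, rfl⟩
    -- `θ' (e.2) = outEquiv [e.1] = outProj (Ψ e.1)` and `Ψ e.1` lies in the level-`d` kernel
    have hcl : TopOut.mk G e.1.1 = ρ e.1.2 := e.2
    have hval : θ' e.1.2 = outProj hG (profiniteAutEquiv (hG := hG) e.1.1) := by
      change outEquiv hG (ρ e.1.2) = _
      rw [← hcl, outEquiv_mk]
    rw [Set.mem_preimage, hval]
    apply hd
    change ((toProfiniteAut hG e.1.1).1 d : contMulAut G ⧸ autLevelKer G d) = 1
    rw [toProfiniteAut_apply, QuotientGroup.eq_one_iff]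
    exact mem_autLevelKer_iff.mpr he

end Literature.AnabelianGeometry.AbsoluteAnabelian
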